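import Literature.NumberTheory.EllipticCurves.ComplexMultiplicationDeuringRamified1728KProofs
import Literature.NumberTheory.EllipticCurves.ComplexMultiplicationDeuringConductor
import Literature.NumberTheory.EllipticCurves.RankinSelbergBaseChangeBadPrimesProofs
import Literature.NumberTheory.EllipticCurves.LFunctionPrimeCoeff
import HarnessLib

set_option linter.dupNamespace false -- `Summit.BirchSwinnertonDyer.BirchSwinnertonDyer.Theorems.…` (summit = sub)
set_option autoImplicit false

/-!
# Crux `EisensteinHeartFlatCMInertBadKPrime` (stmt-BirchSwinnertonDyer-21341), line `hsieh-lambda`, layer 2 (V2) —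
# the branch character `ψ_W ∘ N_{L/K_CM}` is RAMIFIED above every bad prime of `W`: side condition (hψbad) of (L)

Route `BiquadraticEisensteinDescent` (cell `pub/bsd-wall`, width seat `bsd-wall-cm-bed-w1`; lead `bsd-wall-cm-bed-p1`,
skeleton `Cruxes/EisensteinHeartFlatCMInertBadKPrime/Lines/hsieh_lambda.lean` v2.1). THEOREMS ONLY (no definition, no named
fact, no `sorry`); supports stmt-BirchSwinnertonDyer-21341 as a helper; nothing about the crux's input (stub `V4`) or any
case of BSD is asserted.

## What is discharged

Hypothesis (L) of the V2 socket is reduced (`…KatzHsiehLValue` / `…DeuringOverKPrime.polynomial_identity`, width seat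
`bsd-wall-cm-bed-w3`) to Deuring's theorem over `K′` plus three frame side conditions; the first of them is

  `hψbad : ∀ ℓ [Fact ℓ.Prime], ¬ W.HasGoodReductionAtPrime ℓ →
            ∀ w : HeightOneSpectrum (𝓞 L), (ℓ : 𝓞 L) ∈ w.asIdeal → ¬ (ψ.compRelNorm L).IsUnramifiedAt w`

("the branch character `η = ψ ∘ N_{L/K_CM}` is ramified above every bad prime", so that both sides of the Euler-factor
identity are trivial at bad `ℓ`). It is PROVED here (`not_isUnramifiedAt_compRelNorm_of_bad`, §4) for `W/ℚ` with CM by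
`𝓞_{K₁}` (`W.j ∈ maximalCMJInvariants`, `IsCMFieldOfJ K₁ W.j`), `ψ` any Hecke character of `K₁` with Deuring's clause
(iii) (`ψ` unramified at `v` iff `W_{K₁}` good at `v` — clause (iii) of `Deuring_exists_heckeCharacter_of_maximalCM`,
a binder), granted that `L/K₁` is UNRAMIFIED above the bad primes (binder `hunr`: at the frame `L = K′·K_CM` and every
bad `ℓ` splits in the Heegner field `K′`). The same §3 gives the `S`-part of (R) (`hramS` of the socket on the primes
above bad `ℓ ≠ p`) once combined with `…BranchRamification.not_isUnramifiedAt_compRelNorm_mul`.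

* §1 `localEulerFactor_ne_one_of_hasGoodReductionAt` — good reduction at `v` forces `L_v ≠ 1` (the Dirichlet
  coefficients of `1/(1 − a_v T + q_v T²)` at `q_v`, `q_v²` cannot both vanish).
* §2 (CM-free) `conductorExponent_baseChange_eq_of_not_le_sq`, `hasGoodReductionAt_baseChange_iff_of_ramificationIdx_eq_one`
  — `f_w(E_F) = f_p(E)` and good reduction is unchanged at a place with `e(w|p) = 1` (A233 over the base `𝓞 ℚ`);
  `hasGoodReductionAt_under_iff` — the place-indexed and prime-indexed predicates at `(ℓ) = w ∩ ℚ`.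
* §3 `not_hasGoodReductionAt_baseChange_cmField` — `E_K` is BAD at every prime of the CM field `K` above a bad `ℓ`
  (`e = 1`: §2; `e = 2`: `Deuring_localEulerFactor_ramified` + §1).
* §4 `not_isUnramifiedAt_of_bad` (`ψ` ramified above bad `ℓ`) and **`not_isUnramifiedAt_compRelNorm_of_bad`** (= `hψbad`).

References: [SilvermanATAEC1994] Ch. II Thm. 9.2 (b), Ex. 2.30–2.32, Ch. IV Thm. 10.2 (a), §11; [SilvermanAEC2009]
Prop. VII.5.1, VII.5.4 (a), §C.16; [Childress2009] Ch. 4 §5 Lemma 5.3 (a); [NeukirchANT1999] Ch. I §8.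
-/

noncomputable section

open scoped Classical NumberField
open NumberField IsDedekindDomain Module Rat.HeightOneSpectrum

namespace Summit.BirchSwinnertonDyer.BirchSwinnertonDyer.Theorems.BiquadraticEisensteinDescentEisensteinHeartFlatCMInertBadKPrimeBranchBadPrimes

open Literature.NumberTheory.EllipticCurves Literature.NumberTheory.GaloisRepresentations
open Literature.NumberTheory.DiophantineGeometry

/-! ### §1 Good reduction is visible on the local Euler factor: `L_v(E) ≠ 1` -/

section EulerFactor

variable {F : Type*} [Field F] [NumberField F]

/-- **At a place of good reduction the local Euler factor is not `1`.** For `X/F` and a finite place `v` where `X` has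
good reduction, `L_v(X, T) = 1 − a_v T + q_v T²` (`q_v = #κ_v ≥ 2`), so the Dirichlet series `1/L_v(q_v^{-s})`
(Mathlib's `localEulerFactor`) has coefficient `a_v` at `q_v` and `a_v² − q_v` at `q_v²`; were it the unit series both
would vanish, forcing `q_v = 0`. (Contrapositive reading used below: `L_v = 1` — additive reduction — excludes good
reduction.) [cite: SilvermanAEC2009, §C.16 (definition of `L_v(T)`), App. C p. 449–450] -/
theorem localEulerFactor_ne_one_of_hasGoodReductionAt (X : WeierstrassCurve F) (v : HeightOneSpectrum (𝓞 F))
    (h : X.HasGoodReductionAt v) :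
    (X.baseChange (v.adicCompletion F)).localEulerFactor (v.adicCompletionIntegers F) ≠ 1 := by
  set R := v.adicCompletionIntegers F with hR
  set Y := X.baseChange (v.adicCompletion F) with hY
  haveI : Finite (IsLocalRing.ResidueField R) := HeightOneSpectrum.finite_residueField_adicCompletionIntegers F v
  set q : ℕ := Nat.card (IsLocalRing.ResidueField R) with hq
  have hq1 : 1 < q := Finite.one_lt_card
  have hgood : (Y.minimal R).HasGoodReduction R := h
  intro heq
  -- the local polynomial and its first coefficients
  set a : ℤ := (q : ℤ) + 1 - (Nat.card ((Y.minimal R).reduction R).toAffine.Point : ℤ) with ha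
  have hP : Y.localPolynomial R = 1 - Polynomial.C a * Polynomial.X + Polynomial.C (q : ℤ) * Polynomial.X ^ 2 := by
    rw [WeierstrassCurve.localPolynomial, if_pos hgood]
  -- coefficients of the inverse power series at `1` and `2` vanish (they are the coefficients of `1` at `q`, `q²`)
  have hcoef : ∀ k : ℕ, 0 < k → PowerSeries.coeff k (Y.localPowerSeries R) = 0 := by
    intro k hk
    have h1 := congrArg (fun f : ArithmeticFunction ℤ ↦ f (q ^ k)) heq
    simp only [WeierstrassCurve.localEulerFactor] at h1
    rw [← hq, ArithmeticFunction.ofPowerSeries_apply_pow hq1, ArithmeticFunction.one_apply_ne] at h1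
    · exact h1
    · exact (Nat.one_lt_pow hk.ne' hq1).ne'
  -- the defining relation `P · P⁻¹ = 1` in degree `2`: `P₀ (P⁻¹)₂ + P₁ (P⁻¹)₁ + P₂ (P⁻¹)₀ = 0`
  have hconst : PowerSeries.constantCoeff ((Y.localPolynomial R : PowerSeries ℤ)) = ((1 : ℤˣ) : ℤ) := by
    rw [Polynomial.constantCoeff_coe, hP]
    simp
  have hmul := PowerSeries.mul_invOfUnit (Y.localPolynomial R : PowerSeries ℤ) 1 hconst
  have hinv1 : PowerSeries.coeff 1 ((Y.localPolynomial R : PowerSeries ℤ).invOfUnit 1) = 0 := hcoef 1 one_pos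
  have hinv2 : PowerSeries.coeff 2 ((Y.localPolynomial R : PowerSeries ℤ).invOfUnit 1) = 0 := hcoef 2 two_pos
  have hinv0 : PowerSeries.coeff 0 ((Y.localPolynomial R : PowerSeries ℤ).invOfUnit 1) = 1 := by
    rw [PowerSeries.coeff_zero_eq_constantCoeff]
    exact WeierstrassCurve.constantCoeff_localPowerSeries R Y
  have h2 := congrArg (PowerSeries.coeff 2) hmul
  rw [PowerSeries.coeff_mul, Finset.Nat.sum_antidiagonal_eq_sum_range_succ_mk, PowerSeries.coeff_one,
    if_neg two_ne_zero] at h2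
  simp only [Finset.sum_range_succ, Finset.sum_range_zero, zero_add, Nat.sub_zero, Nat.sub_self,
    show 2 - 1 = 1 from rfl] at h2
  rw [hinv0, hinv1, hinv2, mul_zero, mul_zero, add_zero, zero_add, mul_one, Polynomial.coeff_coe, hP,
    Polynomial.coeff_add, Polynomial.coeff_sub, Polynomial.coeff_C_mul, Polynomial.coeff_C_mul,
    Polynomial.coeff_X_pow, Polynomial.coeff_one, Polynomial.coeff_X] at h2
  norm_num at h2
  omega

end EulerFactor

/-! ### §2 Unramified base change: `f_w(E_F) = f_v(E)` and good reduction at `e(w|v) = 1` (A233, CM-free) -/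

section Unramified

variable (W : WeierstrassCurve ℚ) [W.IsElliptic] (F : Type) [Field F] [NumberField F]

/-- **`f_w(E_F) = f_p(E)` above a place with `e(w|p) = 1`** (any elliptic `E/ℚ`, any number field `F`): Ogg's formula and
Tate's algorithm are insensitive to unramified base change — the discharged named fact A233
`kodairaSymbolAt_baseChange_of_ramificationIdx_eq_one_holds`, here over the base `𝓞 ℚ` (the companion
`ComplexMultiplicationDeuringConductor.conductorExponent_baseChange_eq_of_ramificationIdx_eq_one` is the `ℤ`-based form).
[cite: SilvermanAEC2009, Prop. VII.5.4 (a)] [cite: SilvermanATAEC1994, IV §11, proof of 11.1 (PDF p. 367)] -/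
theorem conductorExponent_baseChange_eq_of_not_le_sq (w : HeightOneSpectrum (𝓞 F))
    (he : ¬ (w.under (𝓞 ℚ)).asIdeal.map (algebraMap (𝓞 ℚ) (𝓞 F)) ≤ w.asIdeal ^ 2) :
    (W.baseChange F).conductorExponent w = W.conductorExponent (w.under (𝓞 ℚ)) := by
  haveI : Finite (IsLocalRing.ResidueField (w.adicCompletionIntegers F)) :=
    HeightOneSpectrum.finite_residueField_adicCompletionIntegers F w
  haveI : Finite (IsLocalRing.ResidueField ((w.under (𝓞 ℚ)).adicCompletionIntegers ℚ)) :=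
    HeightOneSpectrum.finite_residueField_adicCompletionIntegers ℚ _
  have hsq : (algebraMap ℚ F).comp (algebraMap (𝓞 ℚ) ℚ) = (algebraMap (𝓞 F) F).comp (algebraMap (𝓞 ℚ) (𝓞 F)) :=
    RingHom.ext fun x ↦ by
      rw [RingHom.comp_apply, RingHom.comp_apply, ← IsScalarTower.algebraMap_apply,
        ← IsScalarTower.algebraMap_apply]
  obtain ⟨hk, hΔ⟩ :=
    kodairaSymbolAt_baseChange_of_ramificationIdx_eq_one_holds F (w.under (𝓞 ℚ)) w W hsq rfl he
  unfold WeierstrassCurve.conductorExponent WeierstrassCurve.numComponentsAt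
  rw [hk, hΔ]

/-- `e(w|v) = 1` in the "`v·𝓞_F ≰ w²`" currency of A233. [cite: NeukirchANT1999, Ch. I §8] -/
theorem not_map_le_sq_of_ramificationIdx_eq_one (w : HeightOneSpectrum (𝓞 F)) (he : w.asIdeal.ramificationIdx (𝓞 ℚ) = 1) :
    ¬ (w.under (𝓞 ℚ)).asIdeal.map (algebraMap (𝓞 ℚ) (𝓞 F)) ≤ w.asIdeal ^ 2 := by
  intro hle
  haveI : w.asIdeal.LiesOver (w.under (𝓞 ℚ)).asIdeal := ⟨rfl⟩
  have hinj : Function.Injective (algebraMap (𝓞 ℚ) (𝓞 F)) := FaithfulSMul.algebraMap_injective _ _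
  have hne : (w.under (𝓞 ℚ)).asIdeal.map (algebraMap (𝓞 ℚ) (𝓞 F)) ≠ ⊥ := fun h ↦
    (w.under (𝓞 ℚ)).ne_bot ((Ideal.map_eq_bot_iff_of_injective hinj).mp h)
  have h1 : (w.under (𝓞 ℚ)).asIdeal.ramificationIdx' w.asIdeal = 1 := by
    rw [Ideal.ramificationIdx'_eq_ramificationIdx' (w.under (𝓞 ℚ)).asIdeal w.asIdeal hne]
    exact he
  have hle1 : (w.under (𝓞 ℚ)).asIdeal.map (algebraMap (𝓞 ℚ) (𝓞 F)) ≤ w.asIdeal :=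
    Ideal.map_le_iff_le_comap.mpr le_rfl
  exact (Ideal.ramificationIdx'_ne_one_iff hle1).mpr hle h1

/-- **Good reduction is insensitive to base change at a place with `e(w|p) = 1`**: `E_F` has good reduction at `w` iff `E`
has good reduction at the place `p = w ∩ ℚ` below (`f_w(E_F) = f_p(E)` and `f = 0 ⟺` good reduction, *ATAEC* IV.10.2 (a),
tree `conductorExponent_eq_zero_iff_holds`). [cite: SilvermanAEC2009, Prop. VII.5.4 (a)] [cite: SilvermanATAEC1994, Ch. IV Thm. 10.2 (a)] -/
theorem hasGoodReductionAt_baseChange_iff_of_ramificationIdx_eq_one (w : HeightOneSpectrum (𝓞 F))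
    (he : w.asIdeal.ramificationIdx (𝓞 ℚ) = 1) :
    (W.baseChange F).HasGoodReductionAt w ↔ W.HasGoodReductionAt (w.under (𝓞 ℚ)) := by
  haveI : Finite (IsLocalRing.ResidueField (w.adicCompletionIntegers F)) :=
    HeightOneSpectrum.finite_residueField_adicCompletionIntegers F w
  haveI : Finite (IsLocalRing.ResidueField ((w.under (𝓞 ℚ)).adicCompletionIntegers ℚ)) :=
    HeightOneSpectrum.finite_residueField_adicCompletionIntegers ℚ _
  haveI : (W.baseChange F).IsElliptic := by rw [WeierstrassCurve.baseChange]; infer_instance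
  have hf := conductorExponent_baseChange_eq_of_not_le_sq W F w (not_map_le_sq_of_ramificationIdx_eq_one F w he)
  rw [← WeierstrassCurve.conductorExponent_eq_zero_iff_holds w (W.baseChange F),
    ← WeierstrassCurve.conductorExponent_eq_zero_iff_holds (w.under (𝓞 ℚ)) W, hf]

omit [W.IsElliptic] in
/-- The place of `ℚ` below a prime `w ∋ ℓ` of `F` is `(ℓ)`: its generator is `ℓ`. [folklore] -/
theorem natGenerator_under_eq (w : HeightOneSpectrum (𝓞 F)) {ℓ : ℕ} (hℓ : ℓ.Prime) (hw : (ℓ : 𝓞 F) ∈ w.asIdeal) :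
    natGenerator (w.under (𝓞 ℚ)) = ℓ := by
  have h1 : ((ℓ : ℕ) : 𝓞 ℚ) ∈ (w.under (𝓞 ℚ)).asIdeal := by
    change algebraMap (𝓞 ℚ) (𝓞 F) (ℓ : 𝓞 ℚ) ∈ w.asIdeal
    rwa [map_natCast]
  have h2 : natGenerator (w.under (𝓞 ℚ)) ∣ ℓ := by
    rw [natGenerator_dvd_iff]
    have h3 := Ideal.mem_map_of_mem (Rat.IsIntegralClosure.intEquiv (𝓞 ℚ)).toRingHom h1
    rw [RingEquiv.toRingHom_eq_coe, RingHom.coe_coe, map_natCast] at h3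
    rw [Ideal.map_coe] at h3
    exact h3
  exact (Nat.prime_dvd_prime_iff_eq (prime_natGenerator _) hℓ).mp h2

omit [W.IsElliptic] in
/-- **Good reduction of `E/ℚ` at the place below `w ∋ ℓ` is good reduction at the prime `ℓ`** (the tree's bridge
`hasGoodReductionAtPrime_iff_hasGoodReductionAt_ringOfIntegers` between the `ℚ_ℓ`-indexed and the place-indexed
predicates, at the place `(ℓ) = w ∩ ℚ`). [cite: SilvermanAEC2009, VII.5 Prop. 5.1 (a)] -/
theorem hasGoodReductionAt_under_iff (w : HeightOneSpectrum (𝓞 F)) {ℓ : ℕ} [hℓ : Fact ℓ.Prime] (hw : (ℓ : 𝓞 F) ∈ w.asIdeal) :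
    W.HasGoodReductionAt (w.under (𝓞 ℚ)) ↔ W.HasGoodReductionAtPrime ℓ := by
  have hgen := natGenerator_under_eq F w hℓ.out hw
  have h := WeierstrassCurve.hasGoodReductionAtPrime_iff_hasGoodReductionAt_ringOfIntegers (w.under (𝓞 ℚ)) W
  subst hgen
  exact h.symm

end Unramified

/-! ### §3 A CM curve over its CM field stays bad above every bad rational prime -/

section CMField

variable (W : WeierstrassCurve ℚ) [W.IsElliptic]

/-- **`E_K` is bad at every prime of the CM field `K` above a bad prime `ℓ` of `E/ℚ`** (`E` with CM by `𝓞_K`,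
`W.j ∈ maximalCMJInvariants`, `IsCMFieldOfJ K W.j`). At a place `v ∋ ℓ` with `e(v|ℓ) = 1` this is unramified base
change (§2, any `E`); at a ramified place (`e(v|ℓ) = 2`, `ℓ ∣ d_K`) the tree's `Deuring_localEulerFactor_ramified`
(Silverman *ATAEC* II Ex. 2.31–2.32: additive reduction of `E_K` at `v`) gives `L_v(E_K) = 1`, impossible under good
reduction (§1). The quadratic trichotomy `placesOver_trichotomy_of_finrank_eq_two` supplies `e ∈ {1, 2}`.
[cite: SilvermanATAEC1994, Ch. II Exercises 2.31(a), 2.32(a) (PDF p. 179) and Ch. II Thm. 9.2 (b)]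
[cite: SilvermanAEC2009, Prop. VII.5.4 (a)] -/
theorem not_hasGoodReductionAt_baseChange_cmField (hj : W.j ∈ maximalCMJInvariants) (K : Type) [Field K]
    [NumberField K] (hK : IsCMFieldOfJ K W.j) {ℓ : ℕ} [Fact ℓ.Prime] (hbad : ¬ W.HasGoodReductionAtPrime ℓ)
    (v : HeightOneSpectrum (𝓞 K)) (hv : (ℓ : 𝓞 K) ∈ v.asIdeal) : ¬ (W.baseChange K).HasGoodReductionAt v := by
  have h2 : finrank ℚ K = 2 := hK.1
  -- `e(v|ℓ) = 1` or `e(v|ℓ) = 2`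
  have he : v.asIdeal.ramificationIdx (𝓞 ℚ) = 1 ∨ v.asIdeal.ramificationIdx (𝓞 ℚ) = 2 := by
    rcases placesOver_trichotomy_of_finrank_eq_two K h2 (v.under (𝓞 ℚ)) with
      ⟨w₁, w₂, -, -, hall⟩ | ⟨w₀, hS, he1, -⟩ | ⟨w₀, hS, he2, -⟩
    · exact Or.inl (hall v rfl).1
    · have hw : v ∈ ({w' : HeightOneSpectrum (𝓞 K) | w'.under (𝓞 ℚ) = v.under (𝓞 ℚ)}) := rfl
      rw [hS, Set.mem_singleton_iff] at hw
      subst hw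
      exact Or.inl he1
    · have hw : v ∈ ({w' : HeightOneSpectrum (𝓞 K) | w'.under (𝓞 ℚ) = v.under (𝓞 ℚ)}) := rfl
      rw [hS, Set.mem_singleton_iff] at hw
      subst hw
      exact Or.inr he2
  intro hgood
  rcases he with he | he
  · exact hbad ((hasGoodReductionAt_under_iff W K v hv).mp
      ((hasGoodReductionAt_baseChange_iff_of_ramificationIdx_eq_one W K v he).mp hgood))
  · exact localEulerFactor_ne_one_of_hasGoodReductionAt (W.baseChange K) v hgood
      (Deuring_localEulerFactor_ramified W hj K hK v he).1

end CMField

/-! ### §4 (hψbad): the branch character `ψ ∘ N_{L/K_CM}` is ramified above every bad prime -/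

section Branch

variable {K₁ L : Type} [Field K₁] [NumberField K₁] [Field L] [NumberField L] [Algebra K₁ L] [IsGalois K₁ L]

omit [NumberField K₁] [NumberField L] [IsGalois K₁ L] in
/-- A prime `w ∋ ℓ` of `L` lies over a prime of `K₁` containing `ℓ`. [folklore] -/
theorem natCast_mem_under {ℓ : ℕ} {w : HeightOneSpectrum (𝓞 L)} (hw : (ℓ : 𝓞 L) ∈ w.asIdeal) :
    (ℓ : 𝓞 K₁) ∈ (w.under (𝓞 K₁)).asIdeal := by
  change algebraMap (𝓞 K₁) (𝓞 L) (ℓ : 𝓞 K₁) ∈ w.asIdeal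
  rwa [map_natCast]

/-- **`ψ_W` is ramified at EVERY prime of `K_CM` above a bad prime of `W`** — for any Hecke character `ψ` of the CM field
`K₁` satisfying Deuring's clause (iii) «`ψ` unramified at `v` iff `W_{K₁}` has good reduction at `v`» (binder `hψ`, the
shape of `Deuring_exists_heckeCharacter_of_maximalCM` (iii)): `W_{K₁}` is bad there (§3).
[cite: SilvermanATAEC1994, Ch. II Thm. 9.2 (b) (PDF p. 165)] -/
theorem not_isUnramifiedAt_of_bad (W : WeierstrassCurve ℚ) [W.IsElliptic] (hj : W.j ∈ maximalCMJInvariants)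
    (hK₁ : IsCMFieldOfJ K₁ W.j) {ψ : HeckeCharacter K₁}
    (hψ : ∀ v : HeightOneSpectrum (𝓞 K₁), ψ.IsUnramifiedAt v ↔ (W.baseChange K₁).HasGoodReductionAt v)
    {ℓ : ℕ} [Fact ℓ.Prime] (hbad : ¬ W.HasGoodReductionAtPrime ℓ) (v : HeightOneSpectrum (𝓞 K₁))
    (hv : (ℓ : 𝓞 K₁) ∈ v.asIdeal) : ¬ ψ.IsUnramifiedAt v := fun h ↦
  not_hasGoodReductionAt_baseChange_cmField W hj K₁ hK₁ hbad v hv ((hψ v).mp h)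

/-- **(hψbad) — the side condition of `…DeuringOverKPrime.polynomial_identity` in its literal shape.** For `W/ℚ` with CM
by `𝓞_{K₁}` (`W.j ∈ maximalCMJInvariants`, `IsCMFieldOfJ K₁ W.j`), `L ⊇ K₁` Galois, `ψ` a Hecke character of `K₁` with
Deuring's clause (iii), and `L/K₁` UNRAMIFIED above every bad prime `ℓ` of `W` (binder `hunr`; at the route's frame
`L = K_CM·K′` with every bad `ℓ` split in the Heegner field `K′`, so `L/K_CM` is unramified above `ℓ`): for every bad `ℓ`
and every prime `w ∋ ℓ` of `L`, `ψ ∘ N_{L/K₁} = ψ.compRelNorm L` is RAMIFIED at `w` (`ψ` is ramified at `w ∩ K₁` and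
unramifiedness descends along the norm at an unramified prime, Childress Lemma 5.3 (a), tree
`HeckeCharacter.not_isUnramifiedAt_compRelNorm`). [cite: SilvermanATAEC1994, Ch. II Thm. 9.2 (b) (PDF p. 165)]
[cite: Childress2009, Ch. 4 §5 Lemma 5.3 (a) (PDF p. 95)] -/
theorem not_isUnramifiedAt_compRelNorm_of_bad (W : WeierstrassCurve ℚ) [W.IsElliptic]
    (hj : W.j ∈ maximalCMJInvariants) (hK₁ : IsCMFieldOfJ K₁ W.j) {ψ : HeckeCharacter K₁}
    (hψ : ∀ v : HeightOneSpectrum (𝓞 K₁), ψ.IsUnramifiedAt v ↔ (W.baseChange K₁).HasGoodReductionAt v)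
    (hunr : ∀ (ℓ : ℕ) [Fact ℓ.Prime], ¬ W.HasGoodReductionAtPrime ℓ →
      ∀ v : HeightOneSpectrum (𝓞 K₁), (ℓ : 𝓞 K₁) ∈ v.asIdeal → Algebra.IsUnramifiedIn (𝓞 L) v.asIdeal) :
    ∀ (ℓ : ℕ) [Fact ℓ.Prime], ¬ W.HasGoodReductionAtPrime ℓ →
      ∀ w : HeightOneSpectrum (𝓞 L), (ℓ : 𝓞 L) ∈ w.asIdeal → ¬ (ψ.compRelNorm L).IsUnramifiedAt w := by
  intro ℓ _ hbad w hw
  have hv : (ℓ : 𝓞 K₁) ∈ (w.under (𝓞 K₁)).asIdeal := natCast_mem_under hw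
  exact ψ.not_isUnramifiedAt_compRelNorm (hunr ℓ hbad _ hv)
    (not_isUnramifiedAt_of_bad W hj hK₁ hψ hbad _ hv) rfl

end Branch

end Summit.BirchSwinnertonDyer.BirchSwinnertonDyer.Theorems.BiquadraticEisensteinDescentEisensteinHeartFlatCMInertBadKPrimeBranchBadPrimes

end
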